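import Mathlib
import Summits.ValiantsHypothesis.ValiantsHypothesis.Theorems.NewtonUnitEquationsTwoProductsUniqueWords
import Summits.ValiantsHypothesis.ValiantsHypothesis.Theorems.NewtonUnitEquationsTwoProductsNoSharing

/-! # Brick `stub_engineRowDissociated` — crux `TwoProducts` (stmt-ValiantsHypothesis-5906), line `corner-log-linearization`

ROW DISSOCIATION ⇒ VERTICES ARE ROW LEADERS (lead c9, rung R9b; pure support combinatorics).  For one product
`∏ u_i` of polynomials `u_i ∈ ℂ[x,y]` with constant terms `1`, a *row* of `u_i` is the `y`-exponent `a 1` of a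
support point `a ∈ supp u_i` (`0` is a row of every factor), and a *row word* is `d : Fin n → ℕ` with `d i` a row of
`u_i`.  Hypothesis RD: row words are determined by their sums.  Let `w` be a positive integer weight and `e` a
strict minimiser of `w` on `supp (∏ u − 1) = supp (∏ u) ∖ {0}`; then `e ≠ 0` and `e = ∑ δ_i` for a word `δ`
(`δ i ∈ supp u_i`, word expansion `UniqueWords.uw_coeff_prod`).  If `e 1 = 0` there is nothing to show.  Otherwise
some entry `δ_{i₀}` lies in a positive row `j = (δ i₀) 1`; let `a₀` be the leftmost point of row `j` of `u_{i₀}`.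
Every word `δ'` summing to `a₀` has row word `i ↦ (δ' i) 1` with the same sum `j` as the row word `Pi.single i₀ j`,
so by RD its entries off `i₀` lie on the `x`-axis and `δ' i₀` lies in row `j`, whence
`(δ' i₀) 0 ≥ a₀ 0 = ∑ (δ' i) 0`: the entries off `i₀` vanish and `δ' = Pi.single i₀ a₀`.  So
`(∏ u)[a₀] = u_{i₀}[a₀] ≠ 0`, `a₀ ∈ supp (∏ u − 1)`, and `a₀ ≤ δ_{i₀} ≤ e` componentwise; strict minimality forces
`e = a₀`, the leftmost point of its row of `u_{i₀}`. [folklore] -/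

set_option linter.dupNamespace false -- single-conjunct summit: `ValiantsHypothesis.ValiantsHypothesis`

namespace Summit.ValiantsHypothesis.ValiantsHypothesis.Theorems.TwoProducts.RowDissociated

open scoped BigOperators Classical

open MvPolynomial

open Summit.ValiantsHypothesis.ValiantsHypothesis.Theorems.TwoProducts.UniqueWords
open Summit.ValiantsHypothesis.ValiantsHypothesis.Theorems.TwoProducts.NoSharing

/-- A word with values in `ℕ²` summing to `a`, whose entries off `i₀` lie on the `x`-axis and whose entry at `i₀`
has `x`-coordinate at least `a 0`, is the single-entry word `Pi.single i₀ a`. [folklore] -/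
theorem rd_word_eq_single {n : ℕ} (d : Fin n → (Fin 2 →₀ ℕ)) (i₀ : Fin n) (a : Fin 2 →₀ ℕ)
    (hsum : ∑ i, d i = a) (hrow : ∀ i, i ≠ i₀ → d i 1 = 0) (hx : a 0 ≤ d i₀ 0) :
    d = Pi.single i₀ a := by
  -- the two coordinates of the sum, split at `i₀`
  have h0 : ∑ i, d i 0 = a 0 := by rw [← Finsupp.finsetSum_apply, hsum]
  have h1 : ∑ i, d i 1 = a 1 := by rw [← Finsupp.finsetSum_apply, hsum]
  have hs0 : ∑ i ∈ Finset.univ.erase i₀, d i 0 + d i₀ 0 = ∑ i, d i 0 :=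
    Finset.sum_erase_add Finset.univ (fun i => d i 0) (Finset.mem_univ i₀)
  have hs1 : ∑ i ∈ Finset.univ.erase i₀, d i 1 + d i₀ 1 = ∑ i, d i 1 :=
    Finset.sum_erase_add Finset.univ (fun i => d i 1) (Finset.mem_univ i₀)
  have hrest1 : ∑ i ∈ Finset.univ.erase i₀, d i 1 = 0 :=
    Finset.sum_eq_zero fun i hi => hrow i (Finset.mem_erase.mp hi).1
  -- the `x`-coordinates off `i₀` sum to `0`
  have hrest0 : ∑ i ∈ Finset.univ.erase i₀, d i 0 = 0 := by omega
  have hx0 : ∀ i, i ≠ i₀ → d i 0 = 0 := fun i hi =>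
    Finset.sum_eq_zero_iff.mp hrest0 i (Finset.mem_erase.mpr ⟨hi, Finset.mem_univ i⟩)
  have hi0 : d i₀ 0 = a 0 := by omega
  have hi1 : d i₀ 1 = a 1 := by omega
  funext l
  rcases eq_or_ne l i₀ with rfl | hl
  · rw [Pi.single_eq_same]
    exact Finsupp.ext (Fin.forall_fin_two.mpr ⟨hi0, hi1⟩)
  · rw [Pi.single_eq_of_ne hl]
    exact Finsupp.ext (Fin.forall_fin_two.mpr ⟨hx0 l hl, hrow l hl⟩)

/-- **Row dissociation ⇒ vertices are row leaders.**  Let `u : Fin n → ℂ[x,y]` have constant terms `1` and suppose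
that row words (`d i` a `y`-exponent occurring in `supp u_i`) are determined by their sums.  Then every strict
minimiser `e` of a positive integer weight on `supp (∏ u − 1)` is nonzero, and either lies on the `x`-axis or is
the leftmost point of its row in the support of some factor `u_i`. [folklore] -/
theorem stub_engineRowDissociated : ∀ (n : ℕ) (u : Fin n → MvPolynomial (Fin 2) ℂ),
    (∀ i, MvPolynomial.coeff 0 (u i) = 1) →
    (∀ d d' : Fin n → ℕ, (∀ i, d i ∈ (u i).support.image (fun a : Fin 2 →₀ ℕ => a 1)) →
      (∀ i, d' i ∈ (u i).support.image (fun a : Fin 2 →₀ ℕ => a 1)) → ∑ i, d i = ∑ i, d' i → d = d') →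
    ∀ (w : Fin 2 → ℤ), 0 < w 0 → 0 < w 1 → ∀ (e : Fin 2 →₀ ℕ),
    (e ∈ (∏ i, u i - 1).support ∧ ∀ e' ∈ (∏ i, u i - 1).support, e' ≠ e →
      w 0 * (e 0 : ℤ) + w 1 * (e 1 : ℤ) < w 0 * (e' 0 : ℤ) + w 1 * (e' 1 : ℤ)) →
    e ≠ 0 ∧ (e 1 = 0 ∨ ∃ i, e ∈ (u i).support ∧ ∀ a ∈ (u i).support, a 1 = e 1 → e 0 ≤ a 0) := by
  intro n u hu hRD w hw0 hw1 e he
  obtain ⟨he, hmin⟩ := he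
  -- `0` is a letter, hence `0` is a row, of every factor
  have h0 : ∀ i, (0 : Fin 2 →₀ ℕ) ∈ (u i).support := fun i =>
    mem_support_iff.mpr (by rw [hu i]; exact one_ne_zero)
  have hrow : ∀ i, ∀ a ∈ (u i).support, a 1 ∈ (u i).support.image (fun a : Fin 2 →₀ ℕ => a 1) :=
    fun i a ha => Finset.mem_image_of_mem (fun a : Fin 2 →₀ ℕ => a 1) ha
  -- the constant term of the product is `1`, so the vertex is nonzero
  have hc0 : coeff 0 (∏ i, u i) = 1 := by
    rw [← constantCoeff_eq, map_prod]
    exact Finset.prod_eq_one fun i _ => by rw [constantCoeff_eq, hu i]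
  have he0 : e ≠ 0 := by
    rintro rfl
    exact mem_support_iff.mp he (by rw [coeff_sub, coeff_zero_one, hc0, sub_self])
  -- away from `0`, the coefficients of `∏ u - 1` are those of `∏ u`
  have hc : ∀ a : Fin 2 →₀ ℕ, a ≠ 0 → coeff a (∏ i, u i - 1) = coeff a (∏ i, u i) := by
    intro a ha
    rw [coeff_sub, coeff_one, if_neg (Ne.symm ha), sub_zero]
  have hce : coeff e (∏ i, u i) ≠ 0 := by
    rw [← hc e he0]
    exact mem_support_iff.mp he
  -- the word `d` of the vertex `e`
  obtain ⟨d, hd, hde⟩ : ∃ d : Fin n → (Fin 2 →₀ ℕ), (∀ i, d i ∈ (u i).support) ∧ ∑ i, d i = e := by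
    by_contra hne
    push Not at hne
    exact hce (uw_coeff_prod_of_no_word u (fun i => (u i).support) (fun _ => subset_rfl) e hne)
  refine ⟨he0, ?_⟩
  -- on the `x`-axis there is nothing to show
  rcases Nat.eq_zero_or_pos (e 1) with he1 | he1
  · exact Or.inl he1
  refine Or.inr ?_
  -- off the axis, some entry `d i₀` of the word lies in a positive row
  obtain ⟨i₀, hi₀⟩ : ∃ i, 0 < d i 1 := by
    by_contra hall
    push Not at hall
    have h1 : e 1 = 0 := by
      rw [← hde, Finsupp.finsetSum_apply]
      exact Finset.sum_eq_zero fun i _ => Nat.le_zero.mp (hall i)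
    omega
  -- the leftmost point `a₀` of row `d i₀ 1` of `u i₀`
  obtain ⟨a₀, ha₀R, ha₀min⟩ := ((u i₀).support.filter fun a => a 1 = d i₀ 1).exists_min_image
    (fun a => a 0) ⟨d i₀, Finset.mem_filter.mpr ⟨hd i₀, rfl⟩⟩
  obtain ⟨ha₀i, ha₀1⟩ := Finset.mem_filter.mp ha₀R
  have hm : ∀ a ∈ (u i₀).support, a 1 = d i₀ 1 → a₀ 0 ≤ a 0 := fun a ha ha1 =>
    ha₀min a (Finset.mem_filter.mpr ⟨ha, ha1⟩)
  have ha₀0 : a₀ ≠ 0 := by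
    rintro rfl
    rw [Finsupp.coe_zero, Pi.zero_apply] at ha₀1
    omega
  -- the only word summing to `a₀` is the single-letter word at `i₀`
  have hfib : ∀ d' : Fin n → (Fin 2 →₀ ℕ), (∀ i, d' i ∈ (u i).support) → ∑ i, d' i = a₀ →
      d' = Pi.single i₀ a₀ := by
    intro d' hd' hsum
    have hsum1 : ∑ i, d' i 1 = a₀ 1 := by rw [← Finsupp.finsetSum_apply, hsum]
    have hss : ∑ i, (Pi.single i₀ (a₀ 1) : Fin n → ℕ) i = a₀ 1 := by
      rw [Fintype.sum_eq_single i₀ fun l hl => Pi.single_eq_of_ne hl _, Pi.single_eq_same]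
    -- the row word of `d'` has the same sum as the row word `Pi.single i₀ (a₀ 1)`, so they agree (RD)
    have hrw : (fun i => d' i 1) = Pi.single i₀ (a₀ 1) := by
      refine hRD _ _ (fun i => hrow i _ (hd' i)) (fun i => ?_) (hsum1.trans hss.symm)
      rcases eq_or_ne i i₀ with rfl | hi
      · rw [Pi.single_eq_same]
        exact hrow _ a₀ ha₀i
      · rw [Pi.single_eq_of_ne hi]
        exact hrow i 0 (h0 i)
    have hr : ∀ i, i ≠ i₀ → d' i 1 = 0 := fun i hi => by
      have h := congr_fun hrw i
      rwa [Pi.single_eq_of_ne hi] at h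
    have hri : d' i₀ 1 = a₀ 1 := by
      have h := congr_fun hrw i₀
      rwa [Pi.single_eq_same] at h
    -- `d' i₀` lies in the row of `a₀`, so it is not to the left of `a₀`
    exact rd_word_eq_single d' i₀ a₀ hsum hr (hm _ (hd' i₀) (hri.trans ha₀1))
  have hsingle_mem : ∀ i, (Pi.single i₀ a₀ : Fin n → (Fin 2 →₀ ℕ)) i ∈ (u i).support := by
    intro i
    rcases eq_or_ne i i₀ with rfl | hi
    · rw [Pi.single_eq_same]
      exact ha₀i
    · rw [Pi.single_eq_of_ne hi]
      exact h0 i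
  have hsingle_sum : ∑ i, (Pi.single i₀ a₀ : Fin n → (Fin 2 →₀ ℕ)) i = a₀ := by
    rw [Fintype.sum_eq_single i₀ fun l hl => Pi.single_eq_of_ne hl _, Pi.single_eq_same]
  -- hence `(∏ u)[a₀] = u_{i₀}[a₀] ≠ 0` and `a₀ ∈ supp (∏ u - 1)`
  have hca₀ : coeff a₀ (∏ i, u i) = coeff a₀ (u i₀) := by
    rw [uw_coeff_prod u (fun i => (u i).support) (fun _ => subset_rfl) a₀]
    have hf : (Fintype.piFinset fun i => (u i).support).filter (fun d' => ∑ i, d' i = a₀) =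
        {(Pi.single i₀ a₀ : Fin n → (Fin 2 →₀ ℕ))} := by
      refine Finset.eq_singleton_iff_unique_mem.mpr ⟨?_, fun d' hd' => ?_⟩
      · exact Finset.mem_filter.mpr ⟨Fintype.mem_piFinset.mpr hsingle_mem, hsingle_sum⟩
      · obtain ⟨h1, h2⟩ := Finset.mem_filter.mp hd'
        exact hfib d' (Fintype.mem_piFinset.mp h1) h2
    rw [hf, Finset.sum_singleton, Fintype.prod_eq_single i₀ ?_, Pi.single_eq_same]
    intro l hl
    rw [Pi.single_eq_of_ne hl, hu]
  have ha₀supp : a₀ ∈ (∏ i, u i - 1).support := by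
    rw [mem_support_iff, hc a₀ ha₀0, hca₀]
    exact mem_support_iff.mp ha₀i
  -- `a₀ ≤ d i₀ ≤ e` componentwise; strict minimality gives `e = a₀`
  have hie : d i₀ ≤ e := by
    rw [← hde]
    exact ns_entry_le_sum d i₀
  have hle : a₀ ≤ e :=
    Finsupp.le_def.mpr (Fin.forall_fin_two.mpr
      ⟨(hm (d i₀) (hd i₀) rfl).trans (Finsupp.le_def.mp hie 0), ha₀1.le.trans (Finsupp.le_def.mp hie 1)⟩)
  have hea : a₀ = e := by
    by_contra hne
    exact absurd (hmin a₀ ha₀supp hne) (not_lt.mpr (ns_weight_mono w hw0 hw1 a₀ e hle))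
  subst hea
  exact ⟨i₀, ha₀i, fun a ha ha1 => hm a ha (ha1.trans ha₀1)⟩

end Summit.ValiantsHypothesis.ValiantsHypothesis.Theorems.TwoProducts.RowDissociated
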